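/-
Copyright (c) 2026 the pub-hodgecm-mathlib formalisation cell (harness21).  Prover seat hodgecm-mathlib-LH4-p07 (g8), req620 Track A «(D-RAM) FOUR-FRAME» squad
(STAGE-1b pre-scoping, heir LEAD F0P3a-plan (g20) T19-24 clause; dealer LH4-plan (g12) STATUS #18 board «p07 (g8): row-(2) type-(2) population»), 2026-09-04.
-/
import Summits.HodgeConjecture.HodgeConjecture.Theorems.F0P3cDyRamBlockGlueLevelCount            -- ★ p858811 (this seat): (C1-P) part 1, O-GLUE COUNT WITH A LEVEL TOKEN; brings ★ p858757 (E1), ★ p857501∕p857479 (g6)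
import Summits.HodgeConjecture.HodgeConjecture.Theorems.F0P3cDyRamBlockCensusOrderFormLevelAxis  -- ★ (this seat): (C1-P) part 2a, the axis in M-letters with the token; brings ★ (C1) p857559, ★ W4, ★ (C), ★ p857411, ★ per-cell norm fibre
import HarnessLib

/-!
# Crux `H413`, line LH4 «(D-RAM) FOUR-FRAME» — STAGE-1b, row (2): organ (C1-P) part 2b «THE BLOCK CENSUS WITH A LEVEL TOKEN, IN M-LETTERS»
# `#{M ∣ SD, Γ·M = M, (Γ − 1)M ⊆ cM} = Σ_{j ≤ J} [lam, lam′ ∈ 𝒪_j]·#levelSet(j,0) + Σ_{b=1}^{R} Σ_{j ≤ J} [lam, lam′ ∈ 𝒪_j]·Σᶠ_{Λ ∈ levelSetDep(j, b; μ′)} #Sol_{2b}(r_Λ)`,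
# `lam′ = (lam − 1)∕jE c`, `μ′ = (lam − jE u)∕jE c`

Cell `hodgecm-mathlib` (D-0151), FLOOR 0, crux item H413 = `stmt-HodgeConjecture-24833`, route of record `HCCMUnconditional`; squad F0∕P3c∕LH4; lane
`--supports stmt-HodgeConjecture-24833 --as helper` (count-neutral; pays NO tier-0 row).  THEOREMS ONLY (no `def`, no instance, no notation, no `sorry`).  DATUM-FREE
(abstract valued fields `E ⊂ M` exactly as ★ (C1) p857559: block form over `E`, line model `(M, jE, ρ, Θ, α; φ, lam, h)` of the plane).

WHAT THIS IS — ★ (C1) `ncard_fixed_selfDual_endoGL_eq_orderForm` WITH THE PROFILE TOKEN `LEV_c : (Γ − 1)·M ⊆ c·M` (`|c| ≤ 1`, guard `|u − 1| ≤ |c|`; at `c = ϖ^a` this is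
`LatticeInLevel ϖ a (Γ − 1) M` of ★ U2G DEFS, the congruence-piece predicate of ★ p858649's STAGE-1b reduction, read on the type-(2) population).  ★ p858811 (part 1) cut the
index sets of ★ p857501; ★ part 2a read the axis cut in M-letters (two multipliers `lam`, `lam′ = (jE c)⁻¹(lam − 1)`); here the CONE cut is read in M-letters: on a cone cell
`B₂` with `φ(B₂) = Λ = x₀·𝒪_j ∈ levelSetDep(j, b; μ)` (`μ = lam − jE u`) the token is `lam′ ∈ 𝒪_j ∧ μ′·Λ^♯ ⊆ Λ` with `μ′ = (jE c)⁻¹μ` (§2), so ★ p857411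
`finsum_coneWParts_eq_sum` with the INDICATOR-WEIGHTED fibre count transports the cut layer to `Σ_j [lam ∈ 𝒪_j ∧ lam′ ∈ 𝒪_j]·Σᶠ_{Λ ∈ levelSetDep(j, b; μ′)} f b j Λ` (§3: the
deeper depth set is a SUB-family of ★ (C1)'s, `levelSetDep(j,b;μ′) ⊆ levelSetDep(j,b;μ)` because `jE c ∈ 𝒪_j`); the weights `f` = ★ T1's norm-residue counts `#Sol_{2b}(r)`, UNCHANGED.
So the depth-`c` profile census of a type-(2) block class is ★ (C1)'s order form with `[IsOrd_j lam] ↦ [IsOrd_j lam ∧ IsOrd_j lam′]` and `μ ↦ μ′` — ONE multiplier at a shifted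
argument: the ★ T5 toric level tables are consumed at `(j, b; μ′)`, no new table KIND (the square token `(Γ − 1)² ⊆ c` adds a second depth multiplier — not here).
* §1 the cut cone index set as `S_b ∩ {token}` (token = `LEV_c(γ₂, B) ∧ (c⁻¹(γ₂ − u))·B^♯ ⊆ B`, representative-free); §2 the token on a presented cell, through `φ`;
* §3 the cut cone layer in M-letters; §4 HEAD.
HONEST LABEL.  Count-neutral lattice bookkeeping; nothing printed is asserted; no census law is stated; `HC_CM` is proved only modulo the 7 printed citations (2 remaining named
inputs: hLiu418 = `stmt-HodgeConjecture-24832`, h413 = `stmt-HodgeConjecture-24833`) until rung 0 closes.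

## References
* [Kottwitz1986BaseChangeUnits] R. E. Kottwitz, *Base change for unit elements of Hecke algebras*, Compositio Math. 60 (1986), §1 pp. 240–241.
* [BruhatTits1972] F. Bruhat, J. Tits, *Groupes réductifs sur un corps local I*, Publ. Math. IHÉS 41 (1972), §10.
* [Jacobowitz1962] R. Jacobowitz, *Hermitian forms over local fields*, Amer. J. Math. 84 (1962), §4.
* [Flicker1998UnitaryFL] Y. Z. Flicker, *Elementary proof of the fundamental lemma for a unitary group*, Canad. J. Math. 50 (1998), p. 84 REMARK.
-/

set_option autoImplicit false

noncomputable section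

open scoped Valued WithZero Matrix MatrixGroups
open WithZero
open scoped Classical
open Literature.NumberTheory.Automorphic Literature.NumberTheory.Automorphic.HermitianLattice Literature.NumberTheory.Automorphic.UnitaryLatticeTree
open Literature.NumberTheory.Rogawski1990
open Literature.NumberTheory.Automorphic.EllipticPlaneAsFieldLine
open Literature.NumberTheory.LocalFields.QuadraticOrder
open Summit.HodgeConjecture.HodgeConjecture.Cruxes.H413.F0P3cDyRamToricCensusDefs
open Summit.HodgeConjecture.HodgeConjecture.Cruxes.H413.F0P3cDyRamWSideOrderCensus
open Summit.HodgeConjecture.HodgeConjecture.Cruxes.H413.F0P3cDyRamConeLevelTransport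
open Summit.HodgeConjecture.HodgeConjecture.Cruxes.H413.F0P3cDyRamBlockGlueCount
open Summit.HodgeConjecture.HodgeConjecture.Cruxes.H413.F0P3cDyRamBlockGluePlane
open Summit.HodgeConjecture.HodgeConjecture.Cruxes.H413.F0P3cDyRamBlockGlueLevelCount
open Summit.HodgeConjecture.HodgeConjecture.Cruxes.H413.F0P3cDyRamBlockCensusOrderForm
open Summit.HodgeConjecture.HodgeConjecture.Cruxes.H413.F0P3cDyRamBlockCensusOrderFormLevelAxis

namespace Summit.HodgeConjecture.HodgeConjecture.Cruxes.H413.F0P3cDyRamBlockCensusOrderFormLevel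

variable {E M : Type*} [Field E] [Valued E ℤᵐ⁰] [Field M] [Valued M ℤᵐ⁰] {ρ Θ : M →+* M} {α : M}

/-! ## §1 The cut cone index set is `S_b ∩ {token}` -/

/-- **`S_b^{c} = S_b ∩ {LEV_c(γ₂, ·) ∧ (c⁻¹(γ₂ − u))·(·)^♯ ⊆ ·}`** (`H₂` hermitian, `σ` an isometric involution, `|c| ≤ 1`, guard `|u − 1| ≤ |c|`): the deep clause at the
representative `w₀` is the deep clause on the whole dual `B^♯ = B + 𝒪w₀` (given `LEV_c` and the guard), and it implies ★ p857377's plain clause because `c` is integral.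
[cite: Jacobowitz1962, §4] [cite: Kottwitz1986BaseChangeUnits, §1 pp. 240–241] -/
theorem levConeIndex_eq_inter (σ : E →+* E) (hσ : ∀ a, σ (σ a) = a) (hvσ : ∀ a, Valued.v (σ a) = Valued.v a) (ϖ : E)
    {H₂ : Matrix (Fin 2) (Fin 2) E} (hH₂σ : (H₂.map σ)ᵀ = H₂) (γ₂ : GL (Fin 2) E) {u c : E} (hc : c ≠ 0) (hc1 : Valued.v c ≤ 1) (huc : Valued.v (u - 1) ≤ Valued.v c) (b : ℕ) :
    {B : Submodule 𝒪[E] (Fin 2 → E) | (∃ g : GL (Fin 2) E, B = latt (g : Matrix (Fin 2) (Fin 2) E)) ∧ mapGL γ₂ B = B ∧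
        (∀ y ∈ B, c⁻¹ • (((γ₂ : Matrix (Fin 2) (Fin 2) E) - 1) *ᵥ y) ∈ B) ∧
        ∃ w₀ : Fin 2 → E, (∀ w, w ∈ B ↔ (w ∈ dualLatt σ H₂ B ∧ Valued.v (pairing σ H₂ w₀ w) ≤ 1)) ∧
          (∀ w ∈ dualLatt σ H₂ B, ∃ (t : E) (a : Fin 2 → E), Valued.v t ≤ 1 ∧ a ∈ B ∧ w = t • w₀ + a) ∧
          Valued.v (pairing σ H₂ w₀ w₀) * Valued.v ϖ ^ (2 * b) = 1 ∧
          c⁻¹ • ((γ₂ : Matrix (Fin 2) (Fin 2) E).mulVec w₀ - u • w₀) ∈ B} =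
      {B : Submodule 𝒪[E] (Fin 2 → E) | (∃ g : GL (Fin 2) E, B = latt (g : Matrix (Fin 2) (Fin 2) E)) ∧ mapGL γ₂ B = B ∧
        ∃ w₀ : Fin 2 → E, (∀ w, w ∈ B ↔ (w ∈ dualLatt σ H₂ B ∧ Valued.v (pairing σ H₂ w₀ w) ≤ 1)) ∧
          (∀ w ∈ dualLatt σ H₂ B, ∃ (t : E) (a : Fin 2 → E), Valued.v t ≤ 1 ∧ a ∈ B ∧ w = t • w₀ + a) ∧
          Valued.v (pairing σ H₂ w₀ w₀) * Valued.v ϖ ^ (2 * b) = 1 ∧ (γ₂ : Matrix (Fin 2) (Fin 2) E).mulVec w₀ - u • w₀ ∈ B} ∩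
      {B : Submodule 𝒪[E] (Fin 2 → E) | (∀ y ∈ B, c⁻¹ • (((γ₂ : Matrix (Fin 2) (Fin 2) E) - 1) *ᵥ y) ∈ B) ∧
        ∀ w ∈ dualLatt σ H₂ B, c⁻¹ • ((γ₂ : Matrix (Fin 2) (Fin 2) E).mulVec w - u • w) ∈ B} := by
  have hH₂h : ∀ a d : Fin 2, σ (H₂ a d) = H₂ d a := fun a d => by
    have e := congrFun (congrFun hH₂σ d) a
    rwa [Matrix.transpose_apply, Matrix.map_apply] at e
  have hsymm₂ : ∀ x y : Fin 2 → E, Valued.v (pairing σ H₂ y x) = Valued.v (pairing σ H₂ x y) := v_pairing_comm_of_hermitian hvσ hσ hH₂h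
  -- `c⁻¹(γ₂ − u)` preserves `B` once `LEV_c(γ₂, B)` and the guard hold
  have hstabc : ∀ {B : Submodule 𝒪[E] (Fin 2 → E)}, (∀ y ∈ B, c⁻¹ • (((γ₂ : Matrix (Fin 2) (Fin 2) E) - 1) *ᵥ y) ∈ B) →
      ∀ a ∈ B, c⁻¹ • ((γ₂ : Matrix (Fin 2) (Fin 2) E).mulVec a - u • a) ∈ B := by
    intro B hW a ha
    have e : c⁻¹ • ((γ₂ : Matrix (Fin 2) (Fin 2) E).mulVec a - u • a) = c⁻¹ • (((γ₂ : Matrix (Fin 2) (Fin 2) E) - 1) *ᵥ a) - (c⁻¹ * (u - 1)) • a := by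
      rw [← sub_one_mulVec_sub_sub_one_smul, smul_sub, mul_smul]
    rw [e]
    have hvc : 0 < Valued.v c := zero_lt_iff.2 ((Valuation.ne_zero_iff _).2 hc)
    have hu' : Valued.v (c⁻¹ * (u - 1)) ≤ 1 := by rw [map_mul, map_inv₀, ← div_eq_inv_mul, div_le_one₀ hvc]; exact huc
    exact B.sub_mem (hW a ha) (B.smul_mem (⟨c⁻¹ * (u - 1), hu'⟩ : 𝒪[E]) ha)
  ext B
  simp only [Set.mem_setOf_eq, Set.mem_inter_iff]
  constructor
  · rintro ⟨hg, hγB, hW, w₀, hG1, hgen, hnorm, hdeep⟩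
    have hplain : (γ₂ : Matrix (Fin 2) (Fin 2) E).mulVec w₀ - u • w₀ ∈ B := by
      have h1 := B.smul_mem (⟨c, hc1⟩ : 𝒪[E]) hdeep
      have e : ((⟨c, hc1⟩ : 𝒪[E]) • (c⁻¹ • ((γ₂ : Matrix (Fin 2) (Fin 2) E).mulVec w₀ - u • w₀)) : Fin 2 → E) =
          (γ₂ : Matrix (Fin 2) (Fin 2) E).mulVec w₀ - u • w₀ := by
        rw [Subring.smul_def]; exact smul_inv_smul₀ hc _
      rwa [e] at h1
    refine ⟨⟨hg, hγB, w₀, hG1, hgen, hnorm, hplain⟩, hW, fun w hw => ?_⟩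
    obtain ⟨t, a, ht, ha, rfl⟩ := hgen w hw
    have e : c⁻¹ • ((γ₂ : Matrix (Fin 2) (Fin 2) E).mulVec (t • w₀ + a) - u • (t • w₀ + a)) =
        t • (c⁻¹ • ((γ₂ : Matrix (Fin 2) (Fin 2) E).mulVec w₀ - u • w₀)) + c⁻¹ • ((γ₂ : Matrix (Fin 2) (Fin 2) E).mulVec a - u • a) := by
      rw [Matrix.mulVec_add, Matrix.mulVec_smul]
      module
    rw [e]
    exact B.add_mem (B.smul_mem (⟨t, ht⟩ : 𝒪[E]) hdeep) (hstabc hW a ha)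
  · rintro ⟨⟨hg, hγB, w₀, hG1, hgen, hnorm, -⟩, hW, hdual⟩
    have hw₀d : w₀ ∈ dualLatt σ H₂ B := fun y hy => by rw [hsymm₂]; exact ((hG1 y).1 hy).2
    exact ⟨hg, hγB, hW, w₀, hG1, hgen, hnorm, hdual w₀ hw₀d⟩

/-! ## §2 The token on a presented cone cell, through the line model -/

/-- **THE TOKEN ON A PRESENTED CELL.**  For the line model `(jE, ρ, Θ, α; φ, lam, h)` and a plane lattice `B` whose image `φ(B) = x₀·𝒪_j` is presented (`x₀ ≠ 0`):
`(LEV_c(γ₂, B) ∧ (c⁻¹(γ₂ − u))·B^♯ ⊆ B) ⟺ (IsOrd_j ((jE c)⁻¹(lam − 1)) ∧ ∀ b′, (∀ x ∈ φB, |hΘ(x)b′ + ρ(hΘ(x)b′)| ≤ 1) → ((jE c)⁻¹(lam − jE u))·b′ ∈ φB)` — the first by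
★ part 2a `forall_inv_smul_sub_one_mulVec_mem_iff` + ★ W3 `forall_mul_mem_iff_isOrd`, the second because `w ∈ B^♯ ⟺ φ w` pairs integrally with `φB` (★ (D4)
`mem_dualLatt_iff_forall_v_herm_le_one`) and `φ(c⁻¹(γ₂w − u·w)) = (jE c)⁻¹(lam − jE u)·φ w`. [cite: Jacobowitz1962, §4] [cite: Flicker1998UnitaryFL, p. 84 REMARK] -/
theorem levToken_iff_lineToken (σ : E →+* E) (H₂ : Matrix (Fin 2) (Fin 2) E) (jE : E →+* M) (h : M)
    (hvρ : ∀ x, Valued.v (ρ x) = Valued.v x) (hjv : ∀ c, Valued.v (jE c) ≤ 1 ↔ Valued.v c ≤ 1)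
    (φ : (Fin 2 → E) →+ M) (hφs : ∀ (c : E) (x : Fin 2 → E), φ (c • x) = jE c * φ x) (hφi : Function.Injective φ) (hφo : Function.Surjective φ)
    {γ₂ : GL (Fin 2) E} {lam : M} (hφγ : ∀ x, φ ((γ₂ : Matrix (Fin 2) (Fin 2) E).mulVec x) = lam * φ x)
    (hform : ∀ x y, jE (pairing σ H₂ x y) = h * Θ (φ x) * φ y + ρ (h * Θ (φ x) * φ y))
    (u c : E) {j : ℕ} {ϖM : M} {B : Submodule 𝒪[E] (Fin 2 → E)} {x₀ : M} (hx₀ : x₀ ≠ 0)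
    (hΛx : ∀ x, x ∈ B.toAddSubgroup.map φ ↔ ∃ z, IsOrd ρ α (ϖM ^ j) z ∧ x = x₀ * z) :
    ((∀ y ∈ B, c⁻¹ • (((γ₂ : Matrix (Fin 2) (Fin 2) E) - 1) *ᵥ y) ∈ B) ∧
        ∀ w ∈ dualLatt σ H₂ B, c⁻¹ • ((γ₂ : Matrix (Fin 2) (Fin 2) E).mulVec w - u • w) ∈ B) ↔
      (IsOrd ρ α (ϖM ^ j) ((jE c)⁻¹ * (lam - 1)) ∧
        ∀ b', (∀ x ∈ B.toAddSubgroup.map φ, Valued.v (h * Θ x * b' + ρ (h * Θ x * b')) ≤ 1) → ((jE c)⁻¹ * (lam - jE u)) * b' ∈ B.toAddSubgroup.map φ) := by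
  have key : ∀ w : Fin 2 → E, φ (c⁻¹ • ((γ₂ : Matrix (Fin 2) (Fin 2) E).mulVec w - u • w)) = (jE c)⁻¹ * (lam - jE u) * φ w := fun w => by
    rw [hφs, map_inv₀, map_sub, hφγ, hφs]; ring
  refine and_congr ?_ ?_
  · rw [forall_inv_smul_sub_one_mulVec_mem_iff jE φ hφs hφi hφγ c B, forall_mul_mem_iff_isOrd hvρ hx₀ hΛx]
  · constructor
    · intro hdual b' hb'
      obtain ⟨w, rfl⟩ := hφo b'
      have hw : w ∈ dualLatt σ H₂ B := (mem_dualLatt_iff_forall_v_herm_le_one σ H₂ jE ρ Θ h hjv φ hform B w).2 hb'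
      rw [← key]
      exact AddSubgroup.mem_map.2 ⟨_, hdual w hw, rfl⟩
    · intro hline w hw
      have hb' := hline (φ w) ((mem_dualLatt_iff_forall_v_herm_le_one σ H₂ jE ρ Θ h hjv φ hform B w).1 hw)
      rw [← key] at hb'
      obtain ⟨y', hy', hyy⟩ := AddSubgroup.mem_map.1 hb'
      rw [← hφi hyy]
      exact hy'

/-! ## §3 The cut cone layer in M-letters -/

/-- A depth set at a DEEPER multiplier is a sub-family: if `Λ = x₀·𝒪_j` is presented and `t ∈ 𝒪_j` (e.g. `t = jE c`, `ρ`-fixed and integral) then the depth clause at `μ′`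
implies the depth clause at `t·μ′`. [cite: Flicker1998UnitaryFL, p. 84 REMARK] -/
theorem depth_mul_of_depth (hvρ : ∀ x, Valued.v (ρ x) = Valued.v x) {h : M} {Λ : AddSubgroup M} {x₀ cj : M} (hx₀ : x₀ ≠ 0)
    (hΛx : ∀ x, x ∈ Λ ↔ ∃ z, IsOrd ρ α cj z ∧ x = x₀ * z) {t μ' : M} (ht : IsOrd ρ α cj t)
    (hdep : ∀ b', (∀ x ∈ Λ, Valued.v (h * Θ x * b' + ρ (h * Θ x * b')) ≤ 1) → μ' * b' ∈ Λ) :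
    ∀ b', (∀ x ∈ Λ, Valued.v (h * Θ x * b' + ρ (h * Θ x * b')) ≤ 1) → (t * μ') * b' ∈ Λ := fun b' hb' => by
  rw [mul_assoc]
  exact (forall_mul_mem_iff_isOrd hvρ hx₀ hΛx t).2 ht _ (hdep b' hb')

/-- **THE CUT CONE LAYER `b ≥ 1` IN M-LETTERS.**  In the frame of ★ (C1) `finsum_ncard_glueFibre_eq_sum_levelSetDep` (block form over `E`, `H₂` hermitian, middle entry `h_W`
a `σ`-fixed unit, `𝒪_E` a PID; line model; `lam ∉ 𝒪_{J+1}`; level sets finite; weight `f` agreeing with `Nat.card Sol_{2b}(r)` on presented cells) and for `c ≠ 0`, `|c| ≤ 1`,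
guard `|u − 1| ≤ |c|`:
`Σᶠ_{B₂ ∈ S_b^{c}} #fibre(ι_W B₂, b) = Σ_{j < J+1} [IsOrd_j lam ∧ IsOrd_j ((jE c)⁻¹(lam − 1))]·Σᶠ_{Λ ∈ levelSetDep(j, b; (jE c)⁻¹(lam − jE u))} f b j Λ`
— §1 + ★ p857411 with the indicator-weighted fibre count, the callback read by §2 and ★ `ncard_glueFibre_eq_natCard_normFibre_of_gen`, and the deeper depth set a sub-family (§3).
[cite: Kottwitz1986BaseChangeUnits, §1 pp. 240–241] [cite: BruhatTits1972, §10] [cite: Jacobowitz1962, §4] -/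
theorem finsum_ncard_glueFibre_lev_eq_sum_levelSetDep [IsPrincipalIdealRing 𝒪[E]] (σ : E →+* E) (hσ : ∀ a, σ (σ a) = a) (hvσ : ∀ a, Valued.v (σ a) = Valued.v a)
    {ϖ : E} (hϖ : Valued.v ϖ = WithZero.exp (-1 : ℤ))
    {H₂ : Matrix (Fin 2) (Fin 2) E} (hH₂ : IsUnit H₂.det) (hH₂σ : (H₂.map σ)ᵀ = H₂) {hW : E} (hhW : Valued.v hW = 1) (hhWσ : σ hW = hW) (jE : E →+* M)
    (hρρ : ∀ x, ρ (ρ x) = x) (hvρ : ∀ x, Valued.v (ρ x) = Valued.v x) (hα : ρ α ≠ α) (hα1 : Valued.v α ≤ 1)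
    (hint : ∀ z : M, Valued.v z ≤ 1 → Valued.v ((z - ρ z) / (α - ρ α)) ≤ 1)
    (hΘΘ : ∀ x, Θ (Θ x) = x) (hΘρ : ∀ x, Θ (ρ x) = ρ (Θ x)) (hvΘ : ∀ x, Valued.v (Θ x) = Valued.v x) (hΘj : ∀ x, Θ (jE x) = jE (σ x))
    (hjv : ∀ c, Valued.v (jE c) ≤ 1 ↔ Valued.v c ≤ 1) (hjfix : ∀ z, ρ z = z ↔ ∃ c, jE c = z)
    (hjpow : ∀ (t : E) (n : ℤ), Valued.v (jE t) = Valued.v (jE ϖ) ^ n ↔ Valued.v t = Valued.v ϖ ^ n)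
    (hEval : ∀ c : M, ρ c = c → c ≠ 0 → Valued.v c ≤ 1 → ∃ n : ℕ, Valued.v c = Valued.v (jE ϖ) ^ n)
    (hϖmax : ∀ t : M, ρ t = t → Valued.v t < 1 → Valued.v t ≤ Valued.v (jE ϖ))
    (φ : (Fin 2 → E) →+ M) (hφs : ∀ (c : E) (x : Fin 2 → E), φ (c • x) = jE c * φ x) (hφi : Function.Injective φ) (hφo : Function.Surjective φ)
    {γ₂ : GL (Fin 2) E} {lam h : M} (hφγ : ∀ x, φ ((γ₂ : Matrix (Fin 2) (Fin 2) E).mulVec x) = lam * φ x) (hlam : Valued.v lam = 1)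
    (hΘh : Θ h = h) (hh : h ≠ 0) (hform : ∀ x y, jE (pairing σ H₂ x y) = h * Θ (φ x) * φ y + ρ (h * Θ (φ x) * φ y))
    (u : E) (hu : Valued.v u ≤ 1) {c : E} (hc : c ≠ 0) (hc1 : Valued.v c ≤ 1) (huc : Valued.v (u - 1) ≤ Valued.v c)
    {b : ℕ} (hb : 1 ≤ b) {J : ℕ} (hJ : ¬ IsOrd ρ α (jE ϖ ^ (J + 1)) lam)
    (hfin : ∀ j, j ≤ J → (levelSet ρ Θ α (jE ϖ) h j b).Finite)
    (f : ℕ → ℕ → AddSubgroup M → ℕ)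
    (hf : ∀ (b j : ℕ) (Λ : AddSubgroup M) (x₀ : M) (r : E), 1 ≤ b → x₀ ≠ 0 →
      (∀ x, x ∈ Λ ↔ ∃ z, IsOrd ρ α (jE ϖ ^ j) z ∧ x = x₀ * z) →
      IsOrd ρ α (jE ϖ ^ j) (dualGen ρ Θ α (jE ϖ ^ j) h x₀) → ¬ IsOrd ρ α (jE ϖ ^ j) (dualGen ρ Θ α (jE ϖ ^ j) h x₀ / jE ϖ) →
      Valued.v (dualGen ρ Θ α (jE ϖ ^ j) h x₀) = Valued.v (jE ϖ) ^ b →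
      (∀ b', (∀ x ∈ Λ, Valued.v (h * Θ x * b' + ρ (h * Θ x * b')) ≤ 1) → (lam - jE u) * b' ∈ Λ) →
      IsOrd ρ α (jE ϖ ^ j) lam → jE r = glueUnit ρ Θ α (jE ϖ ^ j) h (jE ϖ) (jE hW) x₀ b →
      f b j Λ = Nat.card {x : 𝒪[E] ⧸ 𝓂[E] ^ (2 * b) // ∃ u' : 𝒪[E], Ideal.Quotient.mk (𝓂[E] ^ (2 * b)) u' = x ∧
        Valued.v ((u' : E) * σ u' - r) ≤ Valued.v (ϖ ^ (2 * b))}) :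
    ∑ᶠ B₂ ∈ {B : Submodule 𝒪[E] (Fin 2 → E) | (∃ g : GL (Fin 2) E, B = latt (g : Matrix (Fin 2) (Fin 2) E)) ∧ mapGL γ₂ B = B ∧
        (∀ y ∈ B, c⁻¹ • (((γ₂ : Matrix (Fin 2) (Fin 2) E) - 1) *ᵥ y) ∈ B) ∧
        ∃ w₀ : Fin 2 → E, (∀ w, w ∈ B ↔ (w ∈ dualLatt σ H₂ B ∧ Valued.v (pairing σ H₂ w₀ w) ≤ 1)) ∧
          (∀ w ∈ dualLatt σ H₂ B, ∃ (t : E) (a : Fin 2 → E), Valued.v t ≤ 1 ∧ a ∈ B ∧ w = t • w₀ + a) ∧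
          Valued.v (pairing σ H₂ w₀ w₀) * Valued.v ϖ ^ (2 * b) = 1 ∧
          c⁻¹ • ((γ₂ : Matrix (Fin 2) (Fin 2) E).mulVec w₀ - u • w₀) ∈ B},
        {L : Submodule 𝒪[E] (Fin 3 → E) | IsSelfDualLattice σ ϖ (!![H₂ 0 0, 0, H₂ 0 1; 0, hW, 0; H₂ 1 0, 0, H₂ 1 1] : Matrix (Fin 3) (Fin 3) E) L ∧
            L ⊓ LinearMap.ker ((LinearMap.proj (1 : Fin 3) : (Fin 3 → E) →ₗ[E] E).restrictScalars 𝒪[E]) =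
              B₂.map ((Matrix.toLin' (!![1, 0; 0, 0; 0, 1] : Matrix (Fin 3) (Fin 2) E)).restrictScalars 𝒪[E]) ∧
            ∀ c : E, (Pi.single 1 c : Fin 3 → E) ∈ L ↔ Valued.v c ≤ Valued.v ϖ ^ b}.ncard =
      ∑ j ∈ Finset.range (J + 1), (if IsOrd ρ α (jE ϖ ^ j) lam ∧ IsOrd ρ α (jE ϖ ^ j) ((jE c)⁻¹ * (lam - 1)) then
        ∑ᶠ Λ ∈ levelSetDep ρ Θ α (jE ϖ) h j b ((jE c)⁻¹ * (lam - jE u)), f b j Λ else 0) := by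
  have hvϖ0 : Valued.v ϖ ≠ 0 := by rw [hϖ]; exact WithZero.exp_ne_zero
  have hϖ0 : ϖ ≠ 0 := fun h0 => by rw [h0, map_zero] at hvϖ0; exact hvϖ0 rfl
  have hϖ1 : Valued.v ϖ < 1 := by rw [hϖ, ← WithZero.exp_zero, WithZero.exp_lt_exp]; norm_num
  -- §1: the cut index set as `S_b ∩ T`, and the finsum over it as an indicator-weighted finsum over `S_b`
  set T : Set (Submodule 𝒪[E] (Fin 2 → E)) := {B | (∀ y ∈ B, c⁻¹ • (((γ₂ : Matrix (Fin 2) (Fin 2) E) - 1) *ᵥ y) ∈ B) ∧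
    ∀ w ∈ dualLatt σ H₂ B, c⁻¹ • ((γ₂ : Matrix (Fin 2) (Fin 2) E).mulVec w - u • w) ∈ B} with hT
  set fib : Submodule 𝒪[E] (Fin 2 → E) → ℕ := fun B₂ =>
    {L : Submodule 𝒪[E] (Fin 3 → E) | IsSelfDualLattice σ ϖ (!![H₂ 0 0, 0, H₂ 0 1; 0, hW, 0; H₂ 1 0, 0, H₂ 1 1] : Matrix (Fin 3) (Fin 3) E) L ∧
        L ⊓ LinearMap.ker ((LinearMap.proj (1 : Fin 3) : (Fin 3 → E) →ₗ[E] E).restrictScalars 𝒪[E]) =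
          B₂.map ((Matrix.toLin' (!![1, 0; 0, 0; 0, 1] : Matrix (Fin 3) (Fin 2) E)).restrictScalars 𝒪[E]) ∧
        ∀ c : E, (Pi.single 1 c : Fin 3 → E) ∈ L ↔ Valued.v c ≤ Valued.v ϖ ^ b}.ncard with hfib
  rw [levConeIndex_eq_inter σ hσ hvσ ϖ hH₂σ γ₂ hc hc1 huc b]
  rw [show (∑ᶠ B₂ ∈ {B : Submodule 𝒪[E] (Fin 2 → E) | (∃ g : GL (Fin 2) E, B = latt (g : Matrix (Fin 2) (Fin 2) E)) ∧ mapGL γ₂ B = B ∧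
        ∃ w₀ : Fin 2 → E, (∀ w, w ∈ B ↔ (w ∈ dualLatt σ H₂ B ∧ Valued.v (pairing σ H₂ w₀ w) ≤ 1)) ∧
          (∀ w ∈ dualLatt σ H₂ B, ∃ (t : E) (a : Fin 2 → E), Valued.v t ≤ 1 ∧ a ∈ B ∧ w = t • w₀ + a) ∧
          Valued.v (pairing σ H₂ w₀ w₀) * Valued.v ϖ ^ (2 * b) = 1 ∧ (γ₂ : Matrix (Fin 2) (Fin 2) E).mulVec w₀ - u • w₀ ∈ B} ∩ T, fib B₂) =
      ∑ᶠ B₂ ∈ {B : Submodule 𝒪[E] (Fin 2 → E) | (∃ g : GL (Fin 2) E, B = latt (g : Matrix (Fin 2) (Fin 2) E)) ∧ mapGL γ₂ B = B ∧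
        ∃ w₀ : Fin 2 → E, (∀ w, w ∈ B ↔ (w ∈ dualLatt σ H₂ B ∧ Valued.v (pairing σ H₂ w₀ w) ≤ 1)) ∧
          (∀ w ∈ dualLatt σ H₂ B, ∃ (t : E) (a : Fin 2 → E), Valued.v t ≤ 1 ∧ a ∈ B ∧ w = t • w₀ + a) ∧
          Valued.v (pairing σ H₂ w₀ w₀) * Valued.v ϖ ^ (2 * b) = 1 ∧ (γ₂ : Matrix (Fin 2) (Fin 2) E).mulVec w₀ - u • w₀ ∈ B}, T.indicator fib B₂ by
    rw [finsum_mem_def, finsum_mem_def, Set.indicator_indicator]]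
  -- ★ p857411 with the indicator weight
  rw [finsum_coneWParts_eq_sum σ hϖ0 hϖ1 H₂ jE hρρ hvρ hα hα1 hint hΘΘ hΘρ hvΘ hjv hjfix hjpow hEval hϖmax φ hφs hφi hφo hφγ hlam hΘh hh hform hu hb hJ hfin
    (T.indicator fib)
    (fun j Λ => if IsOrd ρ α (jE ϖ ^ j) ((jE c)⁻¹ * (lam - 1)) ∧
      (∀ b', (∀ x ∈ Λ, Valued.v (h * Θ x * b' + ρ (h * Θ x * b')) ≤ 1) → ((jE c)⁻¹ * (lam - jE u)) * b' ∈ Λ) then f b j Λ else 0)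
    fun j B₂ hBdep hlamj => ?_]
  · -- §3: collapse the indicators, conductor by conductor
    refine Finset.sum_congr rfl fun j _ => ?_
    by_cases hlamj : IsOrd ρ α (jE ϖ ^ j) lam
    · rw [if_pos hlamj]
      by_cases hlam' : IsOrd ρ α (jE ϖ ^ j) ((jE c)⁻¹ * (lam - 1))
      · rw [if_pos ⟨hlamj, hlam'⟩]
        -- the deeper depth set is the sub-family cut out by the second clause
        rw [finsum_mem_def, finsum_mem_def]
        refine finsum_congr fun Λ => ?_
        by_cases hΛ' : Λ ∈ levelSetDep ρ Θ α (jE ϖ) h j b ((jE c)⁻¹ * (lam - jE u))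
        · have hΛ'2 := hΛ'
          obtain ⟨hlev, hdep'⟩ := hΛ'2
          have hΛ : Λ ∈ levelSetDep ρ Θ α (jE ϖ) h j b (lam - jE u) := by
            have hlev2 := hlev
            obtain ⟨x₀, hx₀, hΛx, -, -, -⟩ := hlev2
            refine ⟨hlev, fun b' hb' => ?_⟩
            have hcO : IsOrd ρ α (jE ϖ ^ j) (jE c) := mem_order_of_fixed _ ((hjfix _).2 ⟨c, rfl⟩) ((hjv c).2 hc1)
            have h1 := depth_mul_of_depth hvρ hx₀ hΛx hcO hdep' b' hb'
            rwa [← mul_assoc, mul_inv_cancel₀ ((map_ne_zero jE).2 hc), one_mul] at h1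
          rw [Set.indicator_of_mem hΛ, Set.indicator_of_mem hΛ', if_pos ⟨hlam', hdep'⟩]
        · rw [Set.indicator_of_notMem hΛ']
          by_cases hΛ : Λ ∈ levelSetDep ρ Θ α (jE ϖ) h j b (lam - jE u)
          · rw [Set.indicator_of_mem hΛ, if_neg]
            rintro ⟨-, hdep'⟩
            exact hΛ' ⟨hΛ.1, hdep'⟩
          · rw [Set.indicator_of_notMem hΛ]
      · rw [if_neg (fun h' => hlam' h'.2)]
        rw [finsum_mem_def]
        refine finsum_eq_zero_of_forall_eq_zero fun Λ => ?_
        by_cases hΛ : Λ ∈ levelSetDep ρ Θ α (jE ϖ) h j b (lam - jE u)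
        · rw [Set.indicator_of_mem hΛ, if_neg (fun h' => hlam' h'.1)]
        · rw [Set.indicator_of_notMem hΛ]
    · rw [if_neg hlamj, if_neg (fun h' => hlamj h'.1)]
  · -- the callback on a presented cell: §2 for the token, ★ per-cell identity + `hf` for the weight
    obtain ⟨⟨x₀, hx₀, hΛx, hyO, hyprim, hylev⟩, hdepΛ⟩ := hBdep
    have htok := levToken_iff_lineToken σ H₂ jE h hvρ hjv φ hφs hφi hφo hφγ hform u c hx₀ hΛx
    by_cases hTB : B₂ ∈ T
    · rw [Set.indicator_of_mem hTB, if_pos (htok.1 hTB)]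
      obtain ⟨r, hr⟩ := exists_map_eq_glueUnit (ρ := ρ) (Θ := Θ) (α := α) jE hρρ hΘρ hjfix (jE ϖ ^ j) h x₀ ϖ hW b
      simp only [hfib]
      rw [ncard_glueFibre_eq_natCard_normFibre_of_gen σ hσ hvσ hϖ hH₂ hH₂σ hhW hhWσ jE hρρ hvρ hα hα1 hint hΘΘ hΘρ hvΘ hΘj hjv hjfix hjpow hϖmax φ hφs hφi hφo hφγ hlam
          hΘh hh hform u hb hx₀ hΛx hyO hyprim hylev hdepΛ hlamj hr,
        hf b j _ x₀ r hb hx₀ hΛx hyO hyprim hylev hdepΛ hlamj hr]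
    · rw [Set.indicator_of_notMem hTB, if_neg (fun h' => hTB (htok.2 h'))]

/-! ## §4 HEAD — the block census with a level token, in M-letters -/

/-- **(C1-P) THE BLOCK CENSUS WITH A LEVEL TOKEN, IN M-LETTERS (HEAD).**  In the frame of ★ (C1) `ncard_fixed_selfDual_endoGL_eq_orderForm` (block form over `E`, `Γ = endoGL (γ₂, u)`
UNITARY, line model `(M, jE, ρ, Θ, α; φ, lam, h)`, fixed self-dual family finite with tube coordinates `≤ R`, `lam ∉ 𝒪_{J+1}`, level sets finite, weight `f` = norm-residue counts
on presented cells) and for `c ≠ 0`, `|c| ≤ 1` with the guard `|u − 1| ≤ |c|`: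
`#{L ∣ SD, Γ·L = L, L.map (Γ − 1) ≤ c·L} = Σ_{j<J+1} [IsOrd_j lam ∧ IsOrd_j lam′]·#levelSet(j, 0) + Σ_{b ∈ Icc 1 R} Σ_{j<J+1} [IsOrd_j lam ∧ IsOrd_j lam′]·Σᶠ_{Λ ∈ levelSetDep(j, b; μ′)} f b j Λ`
with `lam′ = (jE c)⁻¹(lam − 1)`, `μ′ = (jE c)⁻¹(lam − jE u₀₀)` — ★ p858811 (part 1) ∘ ★ part 2a (axis) ∘ §3 (cone).  ★ (C1) is recovered by dropping the token; for `c = ϖ^a`,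
`a ≥ 1` the LHS token is `LatticeInLevel ϖ a (Γ − 1) L` of ★ U2G DEFS.  The square token (`(Γ − 1)² ⊆ c`) and the `T₊` label are NOT treated here.
[cite: Kottwitz1986BaseChangeUnits, §1 pp. 240–241] [cite: BruhatTits1972, §10] [cite: Jacobowitz1962, §4] [cite: Flicker1998UnitaryFL, p. 84 REMARK] -/
theorem ncard_fixed_selfDual_endoGL_lev_eq_orderForm [IsPrincipalIdealRing 𝒪[E]] (σ : E →+* E) (hσ : ∀ a, σ (σ a) = a) (hvσ : ∀ a, Valued.v (σ a) = Valued.v a)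
    {ϖ : E} (hϖ : Valued.v ϖ = WithZero.exp (-1 : ℤ))
    {H₂ : Matrix (Fin 2) (Fin 2) E} (hH₂ : IsUnit H₂.det) (hH₂σ : (H₂.map σ)ᵀ = H₂) {hW : E} (hhW : Valued.v hW = 1) (hhWσ : σ hW = hW) (jE : E →+* M)
    (hρρ : ∀ x, ρ (ρ x) = x) (hvρ : ∀ x, Valued.v (ρ x) = Valued.v x) (hα : ρ α ≠ α) (hα1 : Valued.v α ≤ 1)
    (hint : ∀ z : M, Valued.v z ≤ 1 → Valued.v ((z - ρ z) / (α - ρ α)) ≤ 1)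
    (hΘΘ : ∀ x, Θ (Θ x) = x) (hΘρ : ∀ x, Θ (ρ x) = ρ (Θ x)) (hvΘ : ∀ x, Valued.v (Θ x) = Valued.v x) (hΘj : ∀ x, Θ (jE x) = jE (σ x))
    (hjv : ∀ c, Valued.v (jE c) ≤ 1 ↔ Valued.v c ≤ 1) (hjfix : ∀ z, ρ z = z ↔ ∃ c, jE c = z)
    (hjpow : ∀ (t : E) (n : ℤ), Valued.v (jE t) = Valued.v (jE ϖ) ^ n ↔ Valued.v t = Valued.v ϖ ^ n)
    (hEval : ∀ c : M, ρ c = c → c ≠ 0 → Valued.v c ≤ 1 → ∃ n : ℕ, Valued.v c = Valued.v (jE ϖ) ^ n)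
    (hϖmax : ∀ t : M, ρ t = t → Valued.v t < 1 → Valued.v t ≤ Valued.v (jE ϖ))
    (φ : (Fin 2 → E) →+ M) (hφs : ∀ (c : E) (x : Fin 2 → E), φ (c • x) = jE c * φ x) (hφi : Function.Injective φ) (hφo : Function.Surjective φ)
    {γ₂ : GL (Fin 2) E} {lam h : M} (hφγ : ∀ x, φ ((γ₂ : Matrix (Fin 2) (Fin 2) E).mulVec x) = lam * φ x) (hlam : Valued.v lam = 1)
    (hΘh : Θ h = h) (hh : h ≠ 0) (hform : ∀ x y, jE (pairing σ H₂ x y) = h * Θ (φ x) * φ y + ρ (h * Θ (φ x) * φ y))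
    (u : GL (Fin 1) E) (hΓ : endoGL (γ₂, u) ∈ unitaryGroupOfForm σ (!![H₂ 0 0, 0, H₂ 0 1; 0, hW, 0; H₂ 1 0, 0, H₂ 1 1] : Matrix (Fin 3) (Fin 3) E))
    (hu : Valued.v ((u : Matrix (Fin 1) (Fin 1) E) 0 0) = 1) {c : E} (hc : c ≠ 0) (hc1 : Valued.v c ≤ 1) (huc : Valued.v ((u : Matrix (Fin 1) (Fin 1) E) 0 0 - 1) ≤ Valued.v c) {R : ℕ}
    (hfinF : {L : Submodule 𝒪[E] (Fin 3 → E) |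
      IsSelfDualLattice σ ϖ (!![H₂ 0 0, 0, H₂ 0 1; 0, hW, 0; H₂ 1 0, 0, H₂ 1 1] : Matrix (Fin 3) (Fin 3) E) L ∧ mapGL (endoGL (γ₂, u)) L = L}.Finite)
    (hR : ∀ L : Submodule 𝒪[E] (Fin 3 → E), IsSelfDualLattice σ ϖ (!![H₂ 0 0, 0, H₂ 0 1; 0, hW, 0; H₂ 1 0, 0, H₂ 1 1] : Matrix (Fin 3) (Fin 3) E) L →
      mapGL (endoGL (γ₂, u)) L = L → ∀ b : ℕ, (∀ c : E, (Pi.single 1 c : Fin 3 → E) ∈ L ↔ Valued.v c ≤ Valued.v ϖ ^ b) → b ≤ R)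
    {J : ℕ} (hJ : ¬ IsOrd ρ α (jE ϖ ^ (J + 1)) lam) (hfinLS : ∀ j a, (levelSet ρ Θ α (jE ϖ) h j a).Finite)
    (f : ℕ → ℕ → AddSubgroup M → ℕ)
    (hf : ∀ (b j : ℕ) (Λ : AddSubgroup M) (x₀ : M) (r : E), 1 ≤ b → x₀ ≠ 0 →
      (∀ x, x ∈ Λ ↔ ∃ z, IsOrd ρ α (jE ϖ ^ j) z ∧ x = x₀ * z) →
      IsOrd ρ α (jE ϖ ^ j) (dualGen ρ Θ α (jE ϖ ^ j) h x₀) → ¬ IsOrd ρ α (jE ϖ ^ j) (dualGen ρ Θ α (jE ϖ ^ j) h x₀ / jE ϖ) →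
      Valued.v (dualGen ρ Θ α (jE ϖ ^ j) h x₀) = Valued.v (jE ϖ) ^ b →
      (∀ b', (∀ x ∈ Λ, Valued.v (h * Θ x * b' + ρ (h * Θ x * b')) ≤ 1) → (lam - jE ((u : Matrix (Fin 1) (Fin 1) E) 0 0)) * b' ∈ Λ) →
      IsOrd ρ α (jE ϖ ^ j) lam → jE r = glueUnit ρ Θ α (jE ϖ ^ j) h (jE ϖ) (jE hW) x₀ b →
      f b j Λ = Nat.card {x : 𝒪[E] ⧸ 𝓂[E] ^ (2 * b) // ∃ u' : 𝒪[E], Ideal.Quotient.mk (𝓂[E] ^ (2 * b)) u' = x ∧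
        Valued.v ((u' : E) * σ u' - r) ≤ Valued.v (ϖ ^ (2 * b))}) :
    {L : Submodule 𝒪[E] (Fin 3 → E) |
        IsSelfDualLattice σ ϖ (!![H₂ 0 0, 0, H₂ 0 1; 0, hW, 0; H₂ 1 0, 0, H₂ 1 1] : Matrix (Fin 3) (Fin 3) E) L ∧ mapGL (endoGL (γ₂, u)) L = L ∧
          L.map ((Matrix.toLin' (((endoGL (γ₂, u) : GL (Fin 3) E) : Matrix (Fin 3) (Fin 3) E) - 1)).restrictScalars 𝒪[E]) ≤ scaleLattice c L}.ncard =
      (∑ j ∈ Finset.range (J + 1), (if IsOrd ρ α (jE ϖ ^ j) lam ∧ IsOrd ρ α (jE ϖ ^ j) ((jE c)⁻¹ * (lam - 1)) then (levelSet ρ Θ α (jE ϖ) h j 0).ncard else 0)) +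
        ∑ b ∈ Finset.Icc 1 R, ∑ j ∈ Finset.range (J + 1), (if IsOrd ρ α (jE ϖ ^ j) lam ∧ IsOrd ρ α (jE ϖ ^ j) ((jE c)⁻¹ * (lam - 1)) then
          ∑ᶠ Λ ∈ levelSetDep ρ Θ α (jE ϖ) h j b ((jE c)⁻¹ * (lam - jE ((u : Matrix (Fin 1) (Fin 1) E) 0 0))), f b j Λ else 0) := by
  -- ★ p858811: axis + cut cone layers through the plane
  rw [ncard_fixed_selfDual_endoGL_lev_eq_axis_add_sum σ hσ hvσ hϖ hH₂ hH₂σ hhW γ₂ u hΓ hu hc hc1 huc hfinF hR]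
  congr 1
  · -- the axis: ★ part 2a, after moving the token to the `∀`-spelling
    have hset : {B₂ : Submodule 𝒪[E] (Fin 2 → E) | IsSelfDualLattice σ ϖ H₂ B₂ ∧ mapGL γ₂ B₂ = B₂ ∧
          B₂.map ((Matrix.toLin' ((γ₂ : Matrix (Fin 2) (Fin 2) E) - 1)).restrictScalars 𝒪[E]) ≤ scaleLattice c B₂} =
        {B : Submodule 𝒪[E] (Fin 2 → E) | IsSelfDualLattice σ ϖ H₂ B ∧ mapGL γ₂ B = B ∧ ∀ y ∈ B, c⁻¹ • (((γ₂ : Matrix (Fin 2) (Fin 2) E) - 1) *ᵥ y) ∈ B} := by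
      ext B
      simp only [Set.mem_setOf_eq, map_toLin'_le_scaleLattice_iff_forall_mulVec_mem₂, mem_scaleLattice_iff hc]
    rw [hset]
    exact ncard_selfDual_fixed_lev_plane_eq_sum_levelSet_zero σ hvσ hϖ hH₂ jE hρρ hvρ hα hα1 hint hΘΘ hΘρ hvΘ hjv hjfix hjpow hEval φ hφs hφi hφo hφγ hlam hh hform hJ
      (fun j => hfinLS j 0) c
  · -- the cone layers: §3
    refine Finset.sum_congr rfl fun b hb => ?_
    exact finsum_ncard_glueFibre_lev_eq_sum_levelSetDep σ hσ hvσ hϖ hH₂ hH₂σ hhW hhWσ jE hρρ hvρ hα hα1 hint hΘΘ hΘρ hvΘ hΘj hjv hjfix hjpow hEval hϖmax φ hφs hφi hφo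
      hφγ hlam hΘh hh hform ((u : Matrix (Fin 1) (Fin 1) E) 0 0) hu.le hc hc1 huc (Finset.mem_Icc.1 hb).1 hJ (fun j _ => hfinLS j b) f hf

end Summit.HodgeConjecture.HodgeConjecture.Cruxes.H413.F0P3cDyRamBlockCensusOrderFormLevel

end
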